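import Summits.QuantumFields.BalabanUV.Beta.GAN24.Push3LegTelescope
import Summits.QuantumFields.BalabanUV.Beta.GAN24.Push4Iter

/-!
# `BalabanUV.Beta.GAN24.Push4LegTelescope` — binder row G-an2-4 ∕ (CONV-C), CT-W (the row owner gan24-p1-g22's «CT-W DESIGN v0» `HOME/b2b-balaban-gan24-p1/gen22/CT-W-DESIGN-v0.md`
# §2 (R-CT) ∕ §3 CT-W1, the LEG-WISE shape): THE FOUR-LEG PUSH READ THROUGH FOUR INDEPENDENT LEG FAMILIES `push₄W l r v w X`, ITS ADDITIVITY IN EACH LEG FAMILY ON THE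
# SUMMABLE CLASS, THE ONE-LEG-AT-A-TIME TELESCOPING IDENTITY (four terms), AND THE DIFFERENCE OF TWO k-FOLD TRANSPORTS AS ONE SYMMETRISED SUM OF ONE-LEG-DIFFERENCED
# PUSHES THROUGH THE LEG CHAINS — leaf-01's `Push3LegTelescope` ONE TABLE LEG UP.

NOT IN PRINT; OUR BOOKKEEPING (G-an2-4 formalisation swarm, leaf prover `b2b-balaban-gan24-formalise-leaf-03`, gen 57; drafted as an offer under leaf-06's first refusal
O-leaf06g42-2 on CT-W1 and filed on leaf-06 g42's «GO leaf-03» (journal `CLAIMS.log` W-leaf06g42-1 l.37611); the LEVEL-wise half of CT-W1 is leaf-06's `LinT2CoDressed(Step)` ∕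
`TransportTelescope`; module name PROVISIONAL — the row owner gan24-p1 may rename ∕ re-home ∕ re-cut).  HONEST FRAMING (cell contract, verbatim): «discharging `BetaPertH` makes Bałaban's UV stability UNCONDITIONAL —
a real constructive-QFT result; it is NOT the continuum limit and NOT the Clay problem.»  HONEST DEPENDENCY (verbatim): «continuum YM on T⁴ ⇐ BetaPertH ∧ nine spine estimates
(0/9 proved); BetaPertH ⇐ (D1) ∧ (D4) ∧ CAP+tail; G-an2-4 gates asym, D1 and NE2/3/4.»

WHY.  The k-fold transport of the normalised `T₂` recursion is ONE symmetrised four-leg push through the leg CHAINS (leaf-17's `Push4Iter.transport_symPush`): DRESSED transport = chains of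
dressed one-level legs, UNDRESSED = chains of undressed legs.  Route (R-CT) compares the two «one leg at a time» — but leaf-17's `push₄ l r X` reads the right kernel leg AND both table
legs through the SAME family `r`, so it has no slot in which ONE of those three legs can be differenced.  This module supplies the carrier with four independent slots and the algebra:
* §1 [our object] **`push₄W l r v w X μ y ν y′ := ffRead (Lk l ∘ vertexW v (κ u ↦ vertexW w (X κ u) ν y′) μ y ∘ Rk r)`** — left kernel leg `l`, right kernel leg `r`, OUTER table leg `v`
  (first bond slot, coarse bond `(μ, y)`), INNER table leg `w` (second bond slot, coarse bond `(ν, y′)`); `push₄ l r X = push₄W l r r r X` and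
  `push₄W l r v w X μ y ν y′ = push₃ l r v (κ u ↦ vertexW w (X κ u) ν y′) μ y` (leaf-01's three-leg push of the INNER-VERTEX FAMILY), both by `rfl`.
* §2 the inner-vertex family of a `LocStencil₂` table through BOUNDED inner legs is a `LocStencil` family at the table's rate (leaf-17's `Push4NestAux.abs_vertexW_slice_le`), and is
  additive ∕ homogeneous in the inner leg (`Push3LegTelescope.vertexW_sub_leg`).
* §3 `push₃` is additive in its STENCIL slot on the summable class of `Push3LegTelescope` (left legs bounded with summable fine rows, right legs with summable fine columns, table legs
  bounded; the two stencil families `LocStencil` at positive rates) — the weak-class twin of leaf-01's `Push3.push₃_sub`.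
* §4 **ADDITIVITY OF `push₄W` IN EACH OF ITS FOUR LEG FAMILIES** on that class (table `LocStencil₂ X C δ`, `0 < δ`): `push₄W_sub_left ∕ _right ∕ _outer ∕ _inner`.
* §5 **THE TELESCOPING IDENTITY** `push₄W lᴱ rᴱ vᴱ wᴱ X − push₄W lᴮ rᴮ vᴮ wᴮ X = push₄W (lᴱ−lᴮ) rᴱ vᴱ wᴱ X + push₄W lᴮ (rᴱ−rᴮ) vᴱ wᴱ X + push₄W lᴮ rᴮ (vᴱ−vᴮ) wᴱ X
  + push₄W lᴮ rᴮ vᴮ (wᴱ−wᴮ) X` and its `push₄` instance `push₄_sub_push₄` (the three `r`-slots differenced one at a time); the `LegDecay` class version.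
* §6 **THE TRANSPORT DIFFERENCE**: for two pairs of leg-family sequences localised at positive rates (blocking `N ≥ 1`) and a `LocStencil₂` table at a positive rate,
  `transport (j Y ↦ symB (push₄ (lᴱ j) (rᴱ j) Y)) m (k+1) X − transport (j Y ↦ symB (push₄ (lᴮ j) (rᴮ j) Y)) m (k+1) X = symB (the four one-leg-differenced pushes through the CHAINS
  `legChain lᴱ∕rᴱ∕lᴮ∕rᴮ m k`)` — `[P^E − P^B](m, k+1)` of the design's (R-CT) in closed form; the differenced chain of the route is a pure gauge (CT-2 ∕ `ContactKernelCells` §1: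
  `legChain (respStepBmSeq ρ Lc) m k − respStep = dz λ`), which is where CT-W2's summation by parts starts.
[folklore] throughout: definitional bookkeeping + dominated-`tsum` additivity BY NAME over leaf-17's `Push4` ∕ `Push4NestAux` ∕ `Push4Iter`, leaf-01's `Push3` ∕ `Push3LegTelescope` ∕
`AffineUnroll`; ONE plumbing `def` (`push₄W`), 0 cited facts, 0 `def … : Prop`, 0 sorry.  NO estimate; asserts NO shape of an2's ∕ Bałaban's tables; discharges NOTHING of «T2Shape» ∕
«T2Drift» ∕ (hW, hWall); 0 wall binders; NEVER «G-an2-4 closed» as (CONV-C); NOT D1, NOT BetaPertH, NOT continuum, NOT Clay; not in print — our bookkeeping.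
-/

noncomputable section

open Finset
open scoped BigOperators
open Literature.MathematicalPhysics.QuantumFieldTheory
open Literature.MathematicalPhysics.QuantumFieldTheory.Balaban1983to89
open Literature.MathematicalPhysics.QuantumFieldTheory.Balaban1983to89.Beta
open B12Sec2to5 (l1 l1_nonneg)
open ExpKernelCalculus (MKer comp Zl Zl_nonneg)
open OneStepResolventKernel (Fib LocStencil)
open BalabanCompositeJets (LocStencil₂ summable_slice_of_locStencil summable_slice_of_locStencil₂)
open Summit.QuantumFields.BalabanUV.Beta.GAN24.Push4 (vertexW vertex2W Lk Rk ffRead IsFF isFF_ffRead push₄ push₄_def)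
open Summit.QuantumFields.BalabanUV.Beta.GAN24.Push4NestAux (abs_vertexW_slice_le)
open Summit.QuantumFields.BalabanUV.Beta.GAN24.Push4Bounds (LegDecay)
open Summit.QuantumFields.BalabanUV.Beta.GAN24.Push4Iter (BiTab LegFam symB symB_apply legChain legDecay_legChain transport_symPush)
open Summit.QuantumFields.BalabanUV.Beta.GAN24.AffineUnroll (transport)
open Summit.QuantumFields.BalabanUV.Beta.GAN24.Push3 (push₃ push₃_def vertexW_sub ffRead_sub push₃_smul)
open Summit.QuantumFields.BalabanUV.Beta.GAN24.Push3LegTelescope (vertexW_sub_leg vertexW_smul_leg push₃_smul_left push₃_smul_right push₃_smul_table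
  push₃_sub_left push₃_sub_right push₃_sub_table summable_Lk_mul_of_bdd summable_mul_Rk_of_bdd abs_vertexW_le abs_comp_Lk_vertexW_le)

namespace Summit.QuantumFields.BalabanUV.Beta.GAN24.Push4LegTelescope

variable {d : ℕ}

/-! ## §1 The four-family push -/

/-- [our object] **THE FOUR-LEG PUSH THROUGH FOUR INDEPENDENT LEG FAMILIES**: left kernel leg `l` (`Lk`), right kernel leg `r` (`Rk`), OUTER table leg `v` (the first bond
slot of `X`, read at the coarse bond `(μ, y)`), INNER table leg `w` (the second bond slot, read at `(ν, y′)`), the result read in the ff corner —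
`push₄W l r v w X μ y ν y′ := ffRead (comp (comp (Lk l) (vertexW v (fun κ u ↦ vertexW w (X κ u) ν y′) μ y)) (Rk r))`.  A definition asserting nothing. -/
def push₄W (l r v w : LegFam d) (X : BiTab d) (μ : Fin (d + 1)) (y : Fin (d + 1) → ℤ) (ν : Fin (d + 1)) (y' : Fin (d + 1) → ℤ) :
    MKer (d + 1) (Fib d) :=
  ffRead (comp (comp (Lk l) (vertexW v (fun κ u => vertexW w (X κ u) ν y') μ y)) (Rk r))

variable (l r v w : LegFam d) (X : BiTab d)

/-- [folklore] `push₄W`, by `rfl`. -/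
theorem push₄W_def (μ : Fin (d + 1)) (y : Fin (d + 1) → ℤ) (ν : Fin (d + 1)) (y' : Fin (d + 1) → ℤ) :
    push₄W l r v w X μ y ν y' = ffRead (comp (comp (Lk l) (vertexW v (fun κ u => vertexW w (X κ u) ν y') μ y)) (Rk r)) := rfl

/-- [folklore] **`push₄W` IS leaf-01's THREE-LEG PUSH OF THE INNER-VERTEX FAMILY**: `push₄W l r v w X μ y ν y′ = push₃ l r v (fun κ u ↦ vertexW w (X κ u) ν y′) μ y` (`rfl`). -/
theorem push₄W_eq_push₃ (μ : Fin (d + 1)) (y : Fin (d + 1) → ℤ) (ν : Fin (d + 1)) (y' : Fin (d + 1) → ℤ) :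
    push₄W l r v w X μ y ν y' = push₃ l r v (fun κ u => vertexW w (X κ u) ν y') μ y := rfl

/-- [folklore] **leaf-17's `push₄` IS THE DIAGONAL INSTANCE** `push₄ l r X = push₄W l r r r X` (`rfl`: `vertex2W r X μ y ν y′ = vertexW r (κ u ↦ vertexW r (X κ u) ν y′) μ y`). -/
theorem push₄_eq_push₄W (μ : Fin (d + 1)) (y : Fin (d + 1) → ℤ) (ν : Fin (d + 1)) (y' : Fin (d + 1) → ℤ) :
    push₄ l r X μ y ν y' = push₄W l r r r X μ y ν y' := rfl

/-- [folklore] `push₄W … μ y ν y′` is ff-valued (whatever the legs and the table are). -/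
theorem isFF_push₄W (μ : Fin (d + 1)) (y : Fin (d + 1) → ℤ) (ν : Fin (d + 1)) (y' : Fin (d + 1) → ℤ) : IsFF (push₄W l r v w X μ y ν y') :=
  isFF_ffRead _

variable {l r v w X} {l' r' v' w' : LegFam d}

/-! ## §2 The inner-vertex family -/

/-- [folklore] **THE INNER-VERTEX FAMILY OF A `LocStencil₂` TABLE THROUGH BOUNDED INNER LEGS IS A LOCAL STENCIL FAMILY** at the table's rate, constant
`(d+1)·(C_w·(C·Zl δ))` (leaf-17's `Push4NestAux.abs_vertexW_slice_le`, restated in `LocStencil` currency). -/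
theorem locStencil_inner {Cw : ℝ} (hw : ∀ μ y κ u, |w μ y κ u| ≤ Cw) {C δ : ℝ} (hX : LocStencil₂ X C δ) (hδ : 0 < δ) (ν : Fin (d + 1))
    (y' : Fin (d + 1) → ℤ) : LocStencil (fun κ u => vertexW w (X κ u) ν y') ((d + 1 : ℕ) * (Cw * (C * Zl (d + 1) δ))) δ :=
  fun κ u x z a b => abs_vertexW_slice_le hw ((abs_nonneg _).trans (hw 0 0 0 0)) hX hδ κ u ν y' x z a b

/-- [folklore] **THE INNER-VERTEX FAMILY IS ADDITIVE IN THE INNER LEG** (bounded legs; the slices of a `LocStencil₂` table at a positive rate are summable):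
`(κ u ↦ vertexW (w − w′) (X κ u) ν y′) = (κ u ↦ vertexW w (X κ u) ν y′ − vertexW w′ (X κ u) ν y′)`. -/
theorem inner_sub {Cw Cw' : ℝ} (hw : ∀ μ y κ u, |w μ y κ u| ≤ Cw) (hw' : ∀ μ y κ u, |w' μ y κ u| ≤ Cw') {C δ : ℝ} (hX : LocStencil₂ X C δ)
    (hδ : 0 < δ) (ν : Fin (d + 1)) (y' : Fin (d + 1) → ℤ) :
    (fun κ u => vertexW (w - w') (X κ u) ν y') = fun κ u => vertexW w (X κ u) ν y' - vertexW w' (X κ u) ν y' := by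
  funext κ u
  exact vertexW_sub_leg hw hw' (fun κ' x z a b => summable_slice_of_locStencil₂ hX hδ κ u κ' x z a b) ν y'

/-- [folklore] The inner-vertex family is homogeneous in the inner leg (no hypothesis): `(κ u ↦ vertexW (c • w) (X κ u) ν y′) = (κ u ↦ c • vertexW w (X κ u) ν y′)`. -/
theorem inner_smul (c : ℝ) (ν : Fin (d + 1)) (y' : Fin (d + 1) → ℤ) :
    (fun κ u => vertexW (c • w) (X κ u) ν y') = fun κ u => c • vertexW w (X κ u) ν y' := by
  funext κ u
  exact vertexW_smul_leg w (X κ u) c ν y'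

/-! ## §3 `push₃` is additive in its stencil slot on the summable class -/

/-- [folklore] **leaf-01's THREE-LEG PUSH IS ADDITIVE IN ITS STENCIL SLOT ON THE SUMMABLE CLASS** (the weak-class twin of `Push3.push₃_sub`, which asks `LegDecay` legs): left legs
BOUNDED with SUMMABLE fine rows, right legs with SUMMABLE fine columns, table legs BOUNDED, the two stencil families `LocStencil` at positive rates ⟹
`push₃ l r v (κ u ↦ S κ u − S′ κ u) = push₃ l r v S − push₃ l r v S′` (leaf-01's `Push3.vertexW_sub`, then `KernelWard.comp_sub_right∕left` over `Push3LegTelescope`'s bricks). -/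
theorem push₃_sub_stencil {Cl Cv Cs Cs' δ δ' : ℝ} (hl : ∀ α x' κ x, |l α x' κ x| ≤ Cl) (hls : ∀ α x' κ, Summable fun x => l α x' κ x)
    (hrs : ∀ β z' κ, Summable fun z => r β z' κ z) (hv : ∀ κ' u' κ u, |v κ' u' κ u| ≤ Cv)
    {S S' : Fin (d + 1) → (Fin (d + 1) → ℤ) → MKer (d + 1) (Fib d)} (hS : LocStencil S Cs δ) (hS' : LocStencil S' Cs' δ') (hδ : 0 < δ)
    (hδ' : 0 < δ') (κ' : Fin (d + 1)) (u' : Fin (d + 1) → ℤ) :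
    push₃ l r v (fun κ u => S κ u - S' κ u) κ' u' = push₃ l r v S κ' u' - push₃ l r v S' κ' u' := by
  rw [push₃_def, push₃_def, push₃_def,
    vertexW_sub hv (fun κ x z a b => summable_slice_of_locStencil hS hδ κ x z a b)
      (fun κ x z a b => summable_slice_of_locStencil hS' hδ' κ x z a b) κ' u',
    KernelWard.comp_sub_right (summable_Lk_mul_of_bdd hls (abs_vertexW_le hv hS hδ κ' u'))
      (summable_Lk_mul_of_bdd hls (abs_vertexW_le hv hS' hδ' κ' u')),
    KernelWard.comp_sub_left (summable_mul_Rk_of_bdd (abs_comp_Lk_vertexW_le hl hv hS hδ κ' u') hrs)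
      (summable_mul_Rk_of_bdd (abs_comp_Lk_vertexW_le hl hv hS' hδ' κ' u') hrs),
    ffRead_sub]

/-! ## §4 Homogeneity and additivity of `push₄W` in each of its four leg families -/

section Slots

variable {Cl Cl' Cv Cv' Cw Cw' C δ : ℝ}

/-- [folklore] `push₄W (c • l) r v w X = c • push₄W l r v w X` (entrywise; no hypothesis). -/
theorem push₄W_smul_left (c : ℝ) (μ : Fin (d + 1)) (y : Fin (d + 1) → ℤ) (ν : Fin (d + 1)) (y' : Fin (d + 1) → ℤ) :
    push₄W (c • l) r v w X μ y ν y' = c • push₄W l r v w X μ y ν y' :=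
  push₃_smul_left l r v _ c μ y

/-- [folklore] `push₄W l (c • r) v w X = c • push₄W l r v w X` (no hypothesis). -/
theorem push₄W_smul_right (c : ℝ) (μ : Fin (d + 1)) (y : Fin (d + 1) → ℤ) (ν : Fin (d + 1)) (y' : Fin (d + 1) → ℤ) :
    push₄W l (c • r) v w X μ y ν y' = c • push₄W l r v w X μ y ν y' :=
  push₃_smul_right l r v _ c μ y

/-- [folklore] `push₄W l r (c • v) w X = c • push₄W l r v w X` (no hypothesis). -/
theorem push₄W_smul_outer (c : ℝ) (μ : Fin (d + 1)) (y : Fin (d + 1) → ℤ) (ν : Fin (d + 1)) (y' : Fin (d + 1) → ℤ) :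
    push₄W l r (c • v) w X μ y ν y' = c • push₄W l r v w X μ y ν y' :=
  push₃_smul_table l r v _ c μ y

/-- [folklore] `push₄W l r v (c • w) X = c • push₄W l r v w X` (no hypothesis; the inner vertex is homogeneous, then leaf-01's `push₃_smul`). -/
theorem push₄W_smul_inner (c : ℝ) (μ : Fin (d + 1)) (y : Fin (d + 1) → ℤ) (ν : Fin (d + 1)) (y' : Fin (d + 1) → ℤ) :
    push₄W l r v (c • w) X μ y ν y' = c • push₄W l r v w X μ y ν y' := by
  rw [push₄W_eq_push₃, push₄W_eq_push₃, inner_smul]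
  exact push₃_smul l r v c _ μ y

/-- [folklore] **`push₄W` IS ADDITIVE IN THE LEFT KERNEL LEG ON THE SUMMABLE CLASS**: left legs `l, l′` BOUNDED with SUMMABLE fine rows, right legs with SUMMABLE fine columns,
outer and inner table legs BOUNDED, table `LocStencil₂ X C δ`, `0 < δ` ⟹ `push₄W (l − l′) r v w X = push₄W l r v w X − push₄W l′ r v w X` (= `Push3LegTelescope.push₃_sub_left` on the
inner-vertex family, §2). -/
theorem push₄W_sub_left (hl : ∀ α x' κ x, |l α x' κ x| ≤ Cl) (hls : ∀ α x' κ, Summable fun x => l α x' κ x)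
    (hl' : ∀ α x' κ x, |l' α x' κ x| ≤ Cl') (hl's : ∀ α x' κ, Summable fun x => l' α x' κ x) (hrs : ∀ β z' κ, Summable fun z => r β z' κ z)
    (hv : ∀ μ y κ u, |v μ y κ u| ≤ Cv) (hw : ∀ μ y κ u, |w μ y κ u| ≤ Cw) (hX : LocStencil₂ X C δ) (hδ : 0 < δ)
    (μ : Fin (d + 1)) (y : Fin (d + 1) → ℤ) (ν : Fin (d + 1)) (y' : Fin (d + 1) → ℤ) :
    push₄W (l - l') r v w X μ y ν y' = push₄W l r v w X μ y ν y' - push₄W l' r v w X μ y ν y' :=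
  push₃_sub_left hl hls hl' hl's hrs hv (locStencil_inner hw hX hδ ν y') hδ μ y

/-- [folklore] **`push₄W` IS ADDITIVE IN THE RIGHT KERNEL LEG ON THE SUMMABLE CLASS**: `push₄W l (r − r′) v w X = push₄W l r v w X − push₄W l r′ v w X` (left legs bounded, right legs
`r, r′` with summable fine columns, table legs bounded, `LocStencil₂ X C δ`, `0 < δ`). -/
theorem push₄W_sub_right (hl : ∀ α x' κ x, |l α x' κ x| ≤ Cl) (hrs : ∀ β z' κ, Summable fun z => r β z' κ z)
    (hr's : ∀ β z' κ, Summable fun z => r' β z' κ z) (hv : ∀ μ y κ u, |v μ y κ u| ≤ Cv) (hw : ∀ μ y κ u, |w μ y κ u| ≤ Cw)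
    (hX : LocStencil₂ X C δ) (hδ : 0 < δ) (μ : Fin (d + 1)) (y : Fin (d + 1) → ℤ) (ν : Fin (d + 1)) (y' : Fin (d + 1) → ℤ) :
    push₄W l (r - r') v w X μ y ν y' = push₄W l r v w X μ y ν y' - push₄W l r' v w X μ y ν y' :=
  push₃_sub_right hl hrs hr's hv (locStencil_inner hw hX hδ ν y') hδ μ y

/-- [folklore] **`push₄W` IS ADDITIVE IN THE OUTER TABLE LEG ON THE SUMMABLE CLASS**: `push₄W l r (v − v′) w X = push₄W l r v w X − push₄W l r v′ w X` (left legs bounded with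
summable rows, right legs with summable columns, `v, v′, w` bounded, `LocStencil₂ X C δ`, `0 < δ`). -/
theorem push₄W_sub_outer (hl : ∀ α x' κ x, |l α x' κ x| ≤ Cl) (hls : ∀ α x' κ, Summable fun x => l α x' κ x)
    (hrs : ∀ β z' κ, Summable fun z => r β z' κ z) (hv : ∀ μ y κ u, |v μ y κ u| ≤ Cv) (hv' : ∀ μ y κ u, |v' μ y κ u| ≤ Cv')
    (hw : ∀ μ y κ u, |w μ y κ u| ≤ Cw) (hX : LocStencil₂ X C δ) (hδ : 0 < δ)
    (μ : Fin (d + 1)) (y : Fin (d + 1) → ℤ) (ν : Fin (d + 1)) (y' : Fin (d + 1) → ℤ) :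
    push₄W l r (v - v') w X μ y ν y' = push₄W l r v w X μ y ν y' - push₄W l r v' w X μ y ν y' :=
  push₃_sub_table hl hls hrs hv hv' (locStencil_inner hw hX hδ ν y') hδ μ y

/-- [folklore] **`push₄W` IS ADDITIVE IN THE INNER TABLE LEG ON THE SUMMABLE CLASS**: `push₄W l r v (w − w′) X = push₄W l r v w X − push₄W l r v w′ X` (left legs bounded with
summable rows, right legs with summable columns, `v, w, w′` bounded, `LocStencil₂ X C δ`, `0 < δ`; §2 `inner_sub` then §3 `push₃_sub_stencil`). -/
theorem push₄W_sub_inner (hl : ∀ α x' κ x, |l α x' κ x| ≤ Cl) (hls : ∀ α x' κ, Summable fun x => l α x' κ x)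
    (hrs : ∀ β z' κ, Summable fun z => r β z' κ z) (hv : ∀ μ y κ u, |v μ y κ u| ≤ Cv) (hw : ∀ μ y κ u, |w μ y κ u| ≤ Cw)
    (hw' : ∀ μ y κ u, |w' μ y κ u| ≤ Cw') (hX : LocStencil₂ X C δ) (hδ : 0 < δ)
    (μ : Fin (d + 1)) (y : Fin (d + 1) → ℤ) (ν : Fin (d + 1)) (y' : Fin (d + 1) → ℤ) :
    push₄W l r v (w - w') X μ y ν y' = push₄W l r v w X μ y ν y' - push₄W l r v w' X μ y ν y' := by
  have h := push₃_sub_stencil hl hls hrs hv (locStencil_inner hw hX hδ ν y') (locStencil_inner hw' hX hδ ν y') hδ hδ μ y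
  rw [push₄W_eq_push₃, push₄W_eq_push₃, push₄W_eq_push₃, inner_sub hw hw' hX hδ ν y']
  simpa only using h

end Slots

/-! ## §5 THE ONE-LEG-AT-A-TIME TELESCOPING IDENTITY (four terms) -/

section Telescope

variable {lE lB rE rB vE vB wE wB : LegFam d} {ClE ClB CvE CvB CwE CwB C δ : ℝ}

/-- [folklore] **THE TELESCOPING IDENTITY OF CT-W, LEG-WISE** («one leg at a time», the order of leaf-01's `push₃_telescope` with the inner table leg LAST), on the summable class:
`push₄W lᴱ rᴱ vᴱ wᴱ X − push₄W lᴮ rᴮ vᴮ wᴮ X = push₄W (lᴱ−lᴮ) rᴱ vᴱ wᴱ X + push₄W lᴮ (rᴱ−rᴮ) vᴱ wᴱ X + push₄W lᴮ rᴮ (vᴱ−vᴮ) wᴱ X + push₄W lᴮ rᴮ vᴮ (wᴱ−wᴮ) X` — term 1: the LEFT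
kernel leg replaced by the difference family, the other three as in the first reading; term 2: the RIGHT kernel leg; term 3: the OUTER table leg; term 4: the INNER table leg, the
other three as in the second reading.  In (R-CT) each difference family is a pure gauge `dz λ` (the staircase of CT-2), so each term is a ONE-gauge cell of CT-W2. -/
theorem push₄W_telescope (hlE : ∀ α x' κ x, |lE α x' κ x| ≤ ClE) (hlEs : ∀ α x' κ, Summable fun x => lE α x' κ x)
    (hlB : ∀ α x' κ x, |lB α x' κ x| ≤ ClB) (hlBs : ∀ α x' κ, Summable fun x => lB α x' κ x)
    (hrEs : ∀ β z' κ, Summable fun z => rE β z' κ z) (hrBs : ∀ β z' κ, Summable fun z => rB β z' κ z)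
    (hvE : ∀ μ y κ u, |vE μ y κ u| ≤ CvE) (hvB : ∀ μ y κ u, |vB μ y κ u| ≤ CvB)
    (hwE : ∀ μ y κ u, |wE μ y κ u| ≤ CwE) (hwB : ∀ μ y κ u, |wB μ y κ u| ≤ CwB) (hX : LocStencil₂ X C δ) (hδ : 0 < δ)
    (μ : Fin (d + 1)) (y : Fin (d + 1) → ℤ) (ν : Fin (d + 1)) (y' : Fin (d + 1) → ℤ) :
    push₄W lE rE vE wE X μ y ν y' - push₄W lB rB vB wB X μ y ν y'
      = push₄W (lE - lB) rE vE wE X μ y ν y' + push₄W lB (rE - rB) vE wE X μ y ν y'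
        + push₄W lB rB (vE - vB) wE X μ y ν y' + push₄W lB rB vB (wE - wB) X μ y ν y' := by
  rw [push₄W_sub_left hlE hlEs hlB hlBs hrEs hvE hwE hX hδ, push₄W_sub_right hlB hrEs hrBs hvE hwE hX hδ,
    push₄W_sub_outer hlB hlBs hrBs hvE hvB hwE hX hδ, push₄W_sub_inner hlB hlBs hrBs hvB hwE hwB hX hδ]
  abel

/-- [folklore] The telescoping identity in the REVERSE order (inner table leg first, then outer, then right, then left; the other legs as in the FIRST reading):
`push₄W lᴱ rᴱ vᴱ wᴱ X − push₄W lᴮ rᴮ vᴮ wᴮ X = push₄W lᴱ rᴱ vᴱ (wᴱ−wᴮ) X + push₄W lᴱ rᴱ (vᴱ−vᴮ) wᴮ X + push₄W lᴱ (rᴱ−rᴮ) vᴮ wᴮ X + push₄W (lᴱ−lᴮ) rᴮ vᴮ wᴮ X`. -/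
theorem push₄W_telescope' (hlE : ∀ α x' κ x, |lE α x' κ x| ≤ ClE) (hlEs : ∀ α x' κ, Summable fun x => lE α x' κ x)
    (hlB : ∀ α x' κ x, |lB α x' κ x| ≤ ClB) (hlBs : ∀ α x' κ, Summable fun x => lB α x' κ x)
    (hrEs : ∀ β z' κ, Summable fun z => rE β z' κ z) (hrBs : ∀ β z' κ, Summable fun z => rB β z' κ z)
    (hvE : ∀ μ y κ u, |vE μ y κ u| ≤ CvE) (hvB : ∀ μ y κ u, |vB μ y κ u| ≤ CvB)
    (hwE : ∀ μ y κ u, |wE μ y κ u| ≤ CwE) (hwB : ∀ μ y κ u, |wB μ y κ u| ≤ CwB) (hX : LocStencil₂ X C δ) (hδ : 0 < δ)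
    (μ : Fin (d + 1)) (y : Fin (d + 1) → ℤ) (ν : Fin (d + 1)) (y' : Fin (d + 1) → ℤ) :
    push₄W lE rE vE wE X μ y ν y' - push₄W lB rB vB wB X μ y ν y'
      = push₄W lE rE vE (wE - wB) X μ y ν y' + push₄W lE rE (vE - vB) wB X μ y ν y'
        + push₄W lE (rE - rB) vB wB X μ y ν y' + push₄W (lE - lB) rB vB wB X μ y ν y' := by
  rw [push₄W_sub_inner hlE hlEs hrEs hvE hwE hwB hX hδ, push₄W_sub_outer hlE hlEs hrEs hvE hvB hwB hX hδ,
    push₄W_sub_right hlE hrEs hrBs hvB hwB hX hδ, push₄W_sub_left hlE hlEs hlB hlBs hrBs hvB hwB hX hδ]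
  abel

variable {CrE CrB : ℝ}

/-- [folklore] **THE `push₄` INSTANCE** (leaf-17's push, the family `r` in three slots differenced ONE SLOT AT A TIME): left legs bounded with summable rows, right ∕ table legs
`rᴱ, rᴮ` BOUNDED with SUMMABLE fine columns, `LocStencil₂ X C δ`, `0 < δ` ⟹
`push₄ lᴱ rᴱ X − push₄ lᴮ rᴮ X = push₄W (lᴱ−lᴮ) rᴱ rᴱ rᴱ X + push₄W lᴮ (rᴱ−rᴮ) rᴱ rᴱ X + push₄W lᴮ rᴮ (rᴱ−rᴮ) rᴱ X + push₄W lᴮ rᴮ rᴮ (rᴱ−rᴮ) X`. -/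
theorem push₄_sub_push₄ (hlE : ∀ α x' κ x, |lE α x' κ x| ≤ ClE) (hlEs : ∀ α x' κ, Summable fun x => lE α x' κ x)
    (hlB : ∀ α x' κ x, |lB α x' κ x| ≤ ClB) (hlBs : ∀ α x' κ, Summable fun x => lB α x' κ x)
    (hrE : ∀ μ y κ u, |rE μ y κ u| ≤ CrE) (hrEs : ∀ β z' κ, Summable fun z => rE β z' κ z)
    (hrB : ∀ μ y κ u, |rB μ y κ u| ≤ CrB) (hrBs : ∀ β z' κ, Summable fun z => rB β z' κ z) (hX : LocStencil₂ X C δ) (hδ : 0 < δ)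
    (μ : Fin (d + 1)) (y : Fin (d + 1) → ℤ) (ν : Fin (d + 1)) (y' : Fin (d + 1) → ℤ) :
    push₄ lE rE X μ y ν y' - push₄ lB rB X μ y ν y'
      = push₄W (lE - lB) rE rE rE X μ y ν y' + push₄W lB (rE - rB) rE rE X μ y ν y'
        + push₄W lB rB (rE - rB) rE X μ y ν y' + push₄W lB rB rB (rE - rB) X μ y ν y' := by
  rw [push₄_eq_push₄W, push₄_eq_push₄W]
  exact push₄W_telescope hlE hlEs hlB hlBs hrEs hrBs hrE hrB hrE hrB hX hδ μ y ν y'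

variable {NlE NrE NlB NrB : ℕ} {mlE mrE mlB mrB : ℝ}

/-- [folklore] **THE `push₄` INSTANCE ON THE `LegDecay` CLASS** (the class of leaf-17's `Push4Iter`: every leg family localised at a positive rate — any blockings, any constants —
hence bounded and summable, `Push4Bounds.LegDecay.abs_le ∕ .summable`): `push₄_sub_push₄`. -/
theorem push₄_sub_push₄_of_legDecay (hlE : LegDecay lE NlE ClE mlE) (hmlE : 0 < mlE) (hrE : LegDecay rE NrE CrE mrE) (hmrE : 0 < mrE)
    (hlB : LegDecay lB NlB ClB mlB) (hmlB : 0 < mlB) (hrB : LegDecay rB NrB CrB mrB) (hmrB : 0 < mrB) (hX : LocStencil₂ X C δ) (hδ : 0 < δ)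
    (μ : Fin (d + 1)) (y : Fin (d + 1) → ℤ) (ν : Fin (d + 1)) (y' : Fin (d + 1) → ℤ) :
    push₄ lE rE X μ y ν y' - push₄ lB rB X μ y ν y'
      = push₄W (lE - lB) rE rE rE X μ y ν y' + push₄W lB (rE - rB) rE rE X μ y ν y'
        + push₄W lB rB (rE - rB) rE X μ y ν y' + push₄W lB rB rB (rE - rB) X μ y ν y' :=
  push₄_sub_push₄ (fun α x' κ x => hlE.abs_le hmlE.le α x' κ x) (fun α x' κ => hlE.summable hmlE α x' κ)
    (fun α x' κ x => hlB.abs_le hmlB.le α x' κ x) (fun α x' κ => hlB.summable hmlB α x' κ)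
    (fun μ y κ u => hrE.abs_le hmrE.le μ y κ u) (fun β z' κ => hrE.summable hmrE β z' κ)
    (fun μ y κ u => hrB.abs_le hmrB.le μ y κ u) (fun β z' κ => hrB.summable hmrB β z' κ) hX hδ μ y ν y'

end Telescope

/-! ## §6 The difference of two k-fold transports -/

section Transport

/-- [folklore] The bond symmetrisation is additive: `symB (Y₁ − Y₂) = symB Y₁ − symB Y₂` (pointwise; no hypothesis). -/
theorem symB_sub (Y₁ Y₂ : BiTab d) : symB (Y₁ - Y₂) = symB Y₁ - symB Y₂ := by
  funext μ y ν y'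
  simp only [symB_apply, Pi.sub_apply, ← smul_sub]
  congr 1
  abel

variable {lE rE lB rB : ℕ → LegFam d} {N : ℕ} {X : BiTab d} {C δ : ℝ}

/-- [folklore] **THE DIFFERENCE OF THE k-FOLD TRANSPORTS OF TWO SYMMETRISED PUSH FAMILIES IS ONE SYMMETRISED SUM OF FOUR ONE-LEG-DIFFERENCED PUSHES THROUGH THE LEG CHAINS.**
For leg-family sequences `lᴱ j, rᴱ j, lᴮ j, rᴮ j` each localised at a positive rate at blocking `N ≥ 1` and a table `LocStencil₂ X C δ`, `0 < δ`: with `Lᴱ = legChain lᴱ m k`,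
`Rᴱ = legChain rᴱ m k`, `Lᴮ = legChain lᴮ m k`, `Rᴮ = legChain rᴮ m k`,
`transport (j Y ↦ symB (push₄ (lᴱ j) (rᴱ j) Y)) m (k+1) X − transport (j Y ↦ symB (push₄ (lᴮ j) (rᴮ j) Y)) m (k+1) X
   = symB (push₄W (Lᴱ−Lᴮ) Rᴱ Rᴱ Rᴱ X + push₄W Lᴮ (Rᴱ−Rᴮ) Rᴱ Rᴱ X + push₄W Lᴮ Rᴮ (Rᴱ−Rᴮ) Rᴱ X + push₄W Lᴮ Rᴮ Rᴮ (Rᴱ−Rᴮ) X)`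
(leaf-17's `transport_symPush` on both families, `legDecay_legChain`, §5).  With leaf-01's `AffineUnroll.transport_smul_eq` ∕ leaf-17's `Push4Sym.mmRead_sandwich_vsym_eq_push₄` this is
`[P^E − P^B](m, k+1)` of the row owner's (R-CT) for the `lin4` transports, up to the common scalar `(−c)^{k+1}`. -/
theorem transport_symPush_sub (hN : 1 ≤ N) (hlE : ∀ j, ∃ C m : ℝ, 0 < m ∧ LegDecay (lE j) N C m) (hrE : ∀ j, ∃ C m : ℝ, 0 < m ∧ LegDecay (rE j) N C m)
    (hlB : ∀ j, ∃ C m : ℝ, 0 < m ∧ LegDecay (lB j) N C m) (hrB : ∀ j, ∃ C m : ℝ, 0 < m ∧ LegDecay (rB j) N C m) (hX : LocStencil₂ X C δ) (hδ : 0 < δ)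
    (m k : ℕ) :
    transport (fun j Y => symB (push₄ (lE j) (rE j) Y)) m (k + 1) X - transport (fun j Y => symB (push₄ (lB j) (rB j) Y)) m (k + 1) X
      = symB (fun μ y ν y' =>
          push₄W (legChain lE m k - legChain lB m k) (legChain rE m k) (legChain rE m k) (legChain rE m k) X μ y ν y'
            + push₄W (legChain lB m k) (legChain rE m k - legChain rB m k) (legChain rE m k) (legChain rE m k) X μ y ν y'
            + push₄W (legChain lB m k) (legChain rB m k) (legChain rE m k - legChain rB m k) (legChain rE m k) X μ y ν y'
            + push₄W (legChain lB m k) (legChain rB m k) (legChain rB m k) (legChain rE m k - legChain rB m k) X μ y ν y') := by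
  rw [transport_symPush hN hlE hrE ⟨C, δ, hδ, hX⟩ m k, transport_symPush hN hlB hrB ⟨C, δ, hδ, hX⟩ m k, ← symB_sub]
  congr 1
  funext μ y ν y'
  obtain ⟨CL, mL, hmL, hL⟩ := legDecay_legChain hlE m k
  obtain ⟨CR, mR, hmR, hR⟩ := legDecay_legChain hrE m k
  obtain ⟨CL', mL', hmL', hL'⟩ := legDecay_legChain hlB m k
  obtain ⟨CR', mR', hmR', hR'⟩ := legDecay_legChain hrB m k
  simp only [Pi.sub_apply]
  exact push₄_sub_push₄_of_legDecay hL hmL hR hmR hL' hmL' hR' hmR' hX hδ μ y ν y'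

end Transport

end Summit.QuantumFields.BalabanUV.Beta.GAN24.Push4LegTelescope

end
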